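import Literature.Analysis.FluidPDE.PlanarRedescription
import Literature.Analysis.FluidPDE.PlanarGateTemplate
import HarnessLib

/-!
# Similar re-descriptions: a frozen phase seen through a lattice similarity (the self-similarity clause)

Topic `Literature/Analysis/FluidPDE`. Level-4 data model, part 8 (after `PlanarRedescription.lean`).
The self-similarity clause `hS` of `QuasiSelfSimilar.acm_compatible_blocks_of_generators`
(`QuasiSelfSimilarGenerators.lean`; ACM 2019, §8.1 (e): at `t = 1` the channel of a generator
restricted to the subsquare `p` of `𝒯_{1/5}` IS the channel at `t = 0` of the child generator,
placed by a symmetry of the square and scaled by `1/5`) compares the END keyframe of the last phase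
of a generating move, on one cell, with the START keyframe of the first phase of another move seen
through the similarity `z ↦ σ⁻¹ • (5 z - p)`. Both keyframes are frozen typed chains
(`PlanarTypedChain.lean`), in general with different decompositions, so the comparison is a
re-description in the sense of `PlanarRedescription.lean` — through a similarity and restricted to
a cell. This file provides:

* `Simil` — **rational axis-aligned similarities** `z ↦ (σ_j λ z_{π j} + w_j)_j` with inverse
  (`Simil.inv`, `inv_app_app`, `app_inv_app`) and the pull-back of integer / rational linear forms
  (`pullCB`, `Simil.form_app`, `pullCQ`, `Simil.formQ_app`);
* the **pull-back of typed data**: frame codes (`d4Pull`, a `decide`d table: the code of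
  `M_o ∘ (linear part)`), kinks and profiles (`Kink.pullΞ/pullT`, `Pw.pullΞ/pullT`: positions
  re-based and scaled, material values scaled by `λ⁻²`, displacement values by `λ⁻¹`) and typed
  elements (`ElemQ.pull`), with the EXACT identity `ElemQ.scalar_pull`:
  `Θ_{pull S e}(t, z) = Θ_e(t, S z)` for `λ > 0` (same profile `G`; the stream offsets are reset —
  only scalars are compared at frozen instants);
* preimages of rational rectangles and strips (`RectQ.preim`, `RectQ.StripQ.preim`, exact
  membership lemmas);
* the **similar re-description certificate** `PhaseQ.simRedescribeB P e P' e' S Q cert cert'`: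
  per node of `P` a similar cover entry (`simEntryB`: on every annotated piece, listed nodes of `P'`
  with an `EquivCert` of `PlanarRedescription.lean` between the element and the PULLED element of
  `P'`, the preimages of whose tube rectangles chain-cover the tube rectangle inside `Q` and the
  piece strips), and symmetrically per node of `P'` through `S⁻¹` inside `S(Q)`; and its soundness
  `PhaseQ.scalar_eq_of_simRedescribeB`: `Θ_P(t, z) = Θ_{P'}(t', S z)` for `z ∈ Q` with `z` and
  `S z` in the closed square, at times with the certified clock end values;
* the **child placement** `Simil.ofChild c p` (`λ = 5`) with
  `ofChild_app : (ofChild c p) z = (c.toSymm)⁻¹ • (5 z - p)` — the similarity of the clause `hS` —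
  and `Simil.cell_facts` (a point of the open cell lies in `cellRect p`, in the closed square, and
  is placed in the closed square), so that `hS` on the cell `p` for the pair (last phase of `g` at
  clock `1`, first phase of `childGen g p` at clock `0`) is exactly `scalar_eq_of_simRedescribeB`
  with `S = ofChild (childSym g p) p`, `Q = cellRect p`.

Folklore (bookkeeping of cut-offs, finite sums and exact rational coordinate changes); no named
facts. Infrastructure towards a discharge of `acm_compatible_blocks`
(`QuasiSelfSimilarCompatibleBlocks.lean`).

## References

* G. Alberti, G. Crippa, A. L. Mazzucato, *Exponential self-similar mixing by incompressible
  flows*, J. Amer. Math. Soc. 32 (2019), 445–490, §8.1 (e), §8.9–8.11 (arXiv:1605.02090).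
-/

noncomputable section

open Function Set Filter
open scoped Topology ContDiff

namespace Literature.Analysis.FluidPDE

namespace PlanarKinematics

open Gluing

/-- The plane `ℝ²` as a Euclidean space. [folklore] -/
local notation "E²" => EuclideanSpace ℝ (Fin 2)

/-! ## Axis-aligned similarities with rational data -/

/-- **Rational axis-aligned similarity** `z ↦ (σ_j λ z_{π j} + w_j)_j`: a swap of the axes or not,
a sign per output axis, a scale `λ` and a translation `w`. [folklore] -/
structure Simil where
  /-- swap the axes? -/
  swap : Bool
  /-- negate output axis `j`? -/
  neg : Fin 2 → Bool
  /-- scale -/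
  lam : ℚ
  /-- translation -/
  w : Fin 2 → ℚ

namespace Simil

variable (S : Simil)

/-- The source axis of output axis `j`. [folklore] -/
def src (j : Fin 2) : Fin 2 := if S.swap then GateC.oth j else j

/-- The sign of output axis `j`. [folklore] -/
def sg (j : Fin 2) : ℚ := if S.neg j then -1 else 1

/-- **The map.** [folklore] -/
def app (z : E²) : E² := WithLp.toLp 2 fun j => (S.sg j : ℝ) * S.lam * z (S.src j) + S.w j

/-- Coordinates of the map. [folklore] -/
theorem app_apply (z : E²) (j : Fin 2) : S.app z j = (S.sg j : ℝ) * S.lam * z (S.src j) + S.w j := rfl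

/-- The source map is an involution. [folklore] -/
@[simp] theorem src_src (j : Fin 2) : S.src (S.src j) = j := by
  unfold src; cases S.swap <;> fin_cases j <;> rfl

/-- Signs square to one. [folklore] -/
theorem sg_mul_sg (j : Fin 2) : S.sg j * S.sg j = 1 := by unfold sg; split_ifs <;> norm_num

/-- **The inverse similarity.** [folklore] -/
def inv : Simil :=
  ⟨S.swap, fun i => S.neg (S.src i), 1 / S.lam, fun i => -S.sg (S.src i) * S.w (S.src i) / S.lam⟩

/-- The scale of the inverse. [folklore] -/
@[simp] theorem inv_lam : S.inv.lam = 1 / S.lam := rfl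

/-- The source map of the inverse. [folklore] -/
@[simp] theorem inv_src (j : Fin 2) : S.inv.src j = S.src j := rfl

/-- The signs of the inverse. [folklore] -/
@[simp] theorem inv_sg (j : Fin 2) : S.inv.sg j = S.sg (S.src j) := by simp [inv, sg]

/-- The translation of the inverse. [folklore] -/
@[simp] theorem inv_w (j : Fin 2) : S.inv.w j = -S.sg (S.src j) * S.w (S.src j) / S.lam := rfl

variable {S}

/-- **Left inverse.** [folklore] -/
theorem inv_app_app (hl : S.lam ≠ 0) (z : E²) : S.inv.app (S.app z) = z := by
  have hl' : (S.lam : ℝ) ≠ 0 := by exact_mod_cast hl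
  ext i
  rw [app_apply, app_apply, inv_sg, inv_lam, inv_w, inv_src, src_src]
  have hs : (S.sg (S.src i) : ℝ) * S.sg (S.src i) = 1 := by exact_mod_cast S.sg_mul_sg (S.src i)
  push_cast
  have : (S.sg (S.src i) : ℝ) * (1 / S.lam) * (S.sg (S.src i) * S.lam * z i + S.w (S.src i)) +
      -(S.sg (S.src i) : ℝ) * S.w (S.src i) / S.lam = S.sg (S.src i) * S.sg (S.src i) * z i := by
    field_simp; ring
  rw [this, hs, one_mul]

/-- **Right inverse.** [folklore] -/
theorem app_inv_app (hl : S.lam ≠ 0) (w : E²) : S.app (S.inv.app w) = w := by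
  have hl' : (S.lam : ℝ) ≠ 0 := by exact_mod_cast hl
  ext j
  rw [app_apply, app_apply, inv_sg, inv_lam, inv_w, inv_src, src_src]
  have hs : (S.sg j : ℝ) * S.sg j = 1 := by exact_mod_cast S.sg_mul_sg j
  push_cast
  have : (S.sg j : ℝ) * S.lam * (S.sg j * (1 / S.lam) * w j + -(S.sg j : ℝ) * S.w j / S.lam) + S.w j =
      S.sg j * S.sg j * (w j - S.w j) + S.w j := by
    field_simp; ring
  rw [this, hs]; ring

variable (S)

end Simil

/-- **Pull-back of an integer linear form** by the linear part of a similarity with swap flag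
`sw` and sign flags `n0, n1`: the coefficients `c''_i = c_{π i} σ_{π i}`. [folklore] -/
def pullCB (sw n0 n1 : Bool) (c : ℤ × ℤ) : ℤ × ℤ :=
  let s0 : ℤ := if n0 then -1 else 1
  let s1 : ℤ := if n1 then -1 else 1
  if sw then (c.2 * s1, c.1 * s0) else (c.1 * s0, c.2 * s1)

namespace Simil

variable (S : Simil)

/-- **Pull-back of an integer linear form** by the linear part of `S`. [folklore] -/
def pullC (c : ℤ × ℤ) : ℤ × ℤ := pullCB S.swap (S.neg 0) (S.neg 1) c

/-- **A linear form after the similarity**: `c · S(z) = λ (pullC c) · z + c · w`. [folklore] -/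
theorem form_app (c : ℤ × ℤ) (z : E²) :
    (c.1 : ℝ) * S.app z 0 + (c.2 : ℝ) * S.app z 1 =
      S.lam * (((S.pullC c).1 : ℝ) * z 0 + ((S.pullC c).2 : ℝ) * z 1) + ((c.1 : ℝ) * S.w 0 + (c.2 : ℝ) * S.w 1) := by
  obtain ⟨sw, ng, lam, w⟩ := S
  simp only [app_apply, pullC, pullCB, src, sg]
  rcases Bool.eq_false_or_eq_true (ng 0) with h0 | h0 <;> rcases Bool.eq_false_or_eq_true (ng 1) with h1 | h1 <;>
    cases sw <;> simp [h0, h1, GateC.oth] <;> ring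

/-- The pull-back of forms is additive. [folklore] -/
theorem pullC_add (c c' : ℤ × ℤ) : S.pullC (c.1 + c'.1, c.2 + c'.2) = ((S.pullC c).1 + (S.pullC c').1, (S.pullC c).2 + (S.pullC c').2) := by
  simp only [pullC, pullCB]
  split_ifs <;> simp only [Prod.mk.injEq] <;> constructor <;> ring

/-- The pull-back of forms is subtractive. [folklore] -/
theorem pullC_sub (c c' : ℤ × ℤ) : S.pullC (c.1 - c'.1, c.2 - c'.2) = ((S.pullC c).1 - (S.pullC c').1, (S.pullC c).2 - (S.pullC c').2) := by
  simp only [pullC, pullCB]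
  split_ifs <;> simp only [Prod.mk.injEq] <;> constructor <;> ring

end Simil

/-! ## The pull-back of a `D₄` frame code -/

/-- **Pull-back table of the frame codes**: the code of `M_o ∘ (linear part of S)`. [folklore] -/
def d4Pull (o : Fin 8) (sw n0 n1 : Bool) : Fin 8 :=
  match sw, n0, n1 with
  | false, false, false => (![0, 1, 2, 3, 4, 5, 6, 7] : Fin 8 → Fin 8) o
  | false, false, true => (![1, 0, 3, 2, 5, 4, 7, 6] : Fin 8 → Fin 8) o
  | false, true, false => (![2, 3, 0, 1, 6, 7, 4, 5] : Fin 8 → Fin 8) o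
  | false, true, true => (![3, 2, 1, 0, 7, 6, 5, 4] : Fin 8 → Fin 8) o
  | true, false, false => (![7, 5, 6, 4, 3, 1, 2, 0] : Fin 8 → Fin 8) o
  | true, false, true => (![5, 7, 4, 6, 1, 3, 0, 2] : Fin 8 → Fin 8) o
  | true, true, false => (![6, 4, 7, 5, 2, 0, 3, 1] : Fin 8 → Fin 8) o
  | true, true, true => (![4, 6, 5, 7, 0, 2, 1, 3] : Fin 8 → Fin 8) o

/-- **The pull-back table is correct** (Boolean form). [folklore] -/
theorem d4Pull_rowsB : ∀ (sw n0 n1 : Bool) (o : Fin 8),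
    (d4a (d4Pull o sw n0 n1), d4b (d4Pull o sw n0 n1)) = pullCB sw n0 n1 (d4a o, d4b o) ∧
      (d4c (d4Pull o sw n0 n1), d4d (d4Pull o sw n0 n1)) = pullCB sw n0 n1 (d4c o, d4d o) := by
  decide

/-- **The pull-back table is correct**: both rows of the pulled frame are the pulled rows. [folklore] -/
theorem d4Pull_rows (S : Simil) (o : Fin 8) :
    (d4a (d4Pull o S.swap (S.neg 0) (S.neg 1)), d4b (d4Pull o S.swap (S.neg 0) (S.neg 1))) = S.pullC (d4a o, d4b o) ∧
      (d4c (d4Pull o S.swap (S.neg 0) (S.neg 1)), d4d (d4Pull o S.swap (S.neg 0) (S.neg 1))) = S.pullC (d4c o, d4d o) :=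
  d4Pull_rowsB S.swap (S.neg 0) (S.neg 1) o

/-! ## Pull-back of profiles -/

/-- A list sum of quotients by a constant. [folklore] -/
theorem List.sum_map_div_const {α : Type*} (L : List α) (f : α → ℝ) (c : ℝ) :
    (L.map fun a => f a / c).sum = (L.map f).sum / c := by
  induction L with
  | nil => simp
  | cons a L ih => simp [ih, add_div]

namespace Kink

/-- **Pull-back of a kink of a material map** by `u ↦ λ u + cu` (value scaled by `λ⁻²`). [folklore] -/
def pullΞ (k : Kink) (lam cu : ℚ) : Kink := ⟨Aff.smul (1 / lam) (k.b.sub (Aff.const cu)), Aff.smul (1 / lam) k.J, k.ℓ / lam⟩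

/-- **Pull-back of a kink of a displacement profile** by `u ↦ λ u + cu` (value scaled by `λ⁻¹`). [folklore] -/
def pullT (k : Kink) (lam cu : ℚ) : Kink := ⟨Aff.smul (1 / lam) (k.b.sub (Aff.const cu)), k.J, k.ℓ / lam⟩

/-- The step argument of a pulled kink. [folklore] -/
theorem arg_pull (k : Kink) {lam : ℚ} (hl : lam ≠ 0) (cu : ℚ) (α u : ℝ) :
    (u - (Aff.smul (1 / lam) (k.b.sub (Aff.const cu))).eval α) / ((k.ℓ / lam : ℚ) : ℝ) = (lam * u + cu - k.b.eval α) / k.ℓ := by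
  have hl' : (lam : ℝ) ≠ 0 := by exact_mod_cast hl
  simp only [Aff.eval_smul, Aff.eval_sub, Aff.eval_const]
  push_cast
  by_cases hℓ : (k.ℓ : ℝ) = 0
  · rw [hℓ]; simp
  · field_simp
    ring

/-- The slope of a pulled material kink. [folklore] -/
theorem du_pullΞ (k : Kink) {lam : ℚ} (hl : lam ≠ 0) (cu : ℚ) (α u : ℝ) :
    (k.pullΞ lam cu).du α u = k.du α (lam * u + cu) / lam := by
  simp only [du, arg, pullΞ]
  rw [k.arg_pull hl]
  simp only [Aff.eval_smul]
  push_cast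
  ring

/-- The value of a pulled displacement kink. [folklore] -/
theorem val_pullT (k : Kink) {lam : ℚ} (hl : lam ≠ 0) (cu : ℚ) (α u : ℝ) :
    (k.pullT lam cu).val α u = k.val α (lam * u + cu) / lam := by
  simp only [val, pullT, rampAt_apply]
  rw [k.arg_pull hl]
  have hl' : (lam : ℝ) ≠ 0 := by exact_mod_cast hl
  push_cast
  field_simp

/-- The slope of a pulled displacement kink. [folklore] -/
theorem du_pullT (k : Kink) {lam : ℚ} (hl : lam ≠ 0) (cu : ℚ) (α u : ℝ) :
    (k.pullT lam cu).du α u = k.du α (lam * u + cu) := by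
  simp only [du, arg, pullT]
  rw [k.arg_pull hl]

end Kink

namespace Pw

/-- **Pull-back of a material map** by `u ↦ λ u + cu`: `F(α, λ u + cu) / λ²`. [folklore] -/
def pullΞ (F : Pw) (lam cu : ℚ) : Pw :=
  ⟨Aff.smul (1 / lam ^ 2) (F.c.add (Aff.smul cu F.s)), Aff.smul (1 / lam) F.s, F.kinks.map fun k => k.pullΞ lam cu⟩

/-- **Pull-back of a displacement profile** by `u ↦ λ u + cu`, ordinate shift `cv`:
`(F(α, λ u + cu) - cv) / λ`. [folklore] -/
def pullT (F : Pw) (lam cu cv : ℚ) : Pw :=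
  ⟨Aff.smul (1 / lam) ((F.c.add (Aff.smul cu F.s)).sub (Aff.const cv)), F.s, F.kinks.map fun k => k.pullT lam cu⟩

/-- **Slope of the pulled material map.** [folklore] -/
theorem du_pullΞ (F : Pw) {lam : ℚ} (hl : lam ≠ 0) (cu : ℚ) (α u : ℝ) :
    (F.pullΞ lam cu).du α u = F.du α (lam * u + cu) / lam := by
  simp only [du, pullΞ, List.map_map]
  have : ((F.kinks.map ((fun k : Kink => k.du α u) ∘ fun k => k.pullΞ lam cu))).sum =
      (F.kinks.map fun k : Kink => k.du α (lam * u + cu) / lam).sum := by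
    congr 1; exact List.map_congr_left fun k _ => k.du_pullΞ hl cu α u
  rw [this, List.sum_map_div_const, Aff.eval_smul]
  push_cast
  ring

/-- **Value of the pulled displacement profile.** [folklore] -/
theorem val_pullT (F : Pw) {lam : ℚ} (hl : lam ≠ 0) (cu cv : ℚ) (α u : ℝ) :
    (F.pullT lam cu cv).val α u = (F.val α (lam * u + cu) - cv) / lam := by
  simp only [val, pullT, List.map_map]
  have : ((F.kinks.map ((fun k : Kink => k.val α u) ∘ fun k => k.pullT lam cu))).sum =
      (F.kinks.map fun k : Kink => k.val α (lam * u + cu) / lam).sum := by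
    congr 1; exact List.map_congr_left fun k _ => k.val_pullT hl cu α u
  rw [this, List.sum_map_div_const, Aff.eval_smul, Aff.eval_sub, Aff.eval_add, Aff.eval_smul, Aff.eval_const]
  have hl' : (lam : ℝ) ≠ 0 := by exact_mod_cast hl
  push_cast
  field_simp
  ring

/-- **Slope of the pulled displacement profile.** [folklore] -/
theorem du_pullT (F : Pw) {lam : ℚ} (hl : lam ≠ 0) (cu cv : ℚ) (α u : ℝ) :
    (F.pullT lam cu cv).du α u = F.du α (lam * u + cu) := by
  simp only [du, pullT, List.map_map]
  congr 1
  congr 1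
  exact List.map_congr_left fun k _ => k.du_pullT hl cu α u

end Pw

/-! ## Pull-back of typed elements -/

namespace ElemQ

/-- The abscissa offset `uC · w`. [folklore] -/
def cuOf (e : ElemQ) (S : Simil) : ℚ := e.uC.1 * S.w 0 + e.uC.2 * S.w 1

/-- The ordinate offset `vC · w`. [folklore] -/
def cvOf (e : ElemQ) (S : Simil) : ℚ := e.vC.1 * S.w 0 + e.vC.2 * S.w 1

/-- **Pull-back of a typed element by a similarity**: the element whose scalar is
`z ↦ Θ_e(t, S z)` (same profile; the stream offsets are reset). [folklore] -/
def pull : ElemQ → Simil → ElemQ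
  | run r, S => run ⟨d4Pull r.o S.swap (S.neg 0) (S.neg 1), Aff.smul (1 / S.lam) (r.y.sub (Aff.const ((run r).cvOf S))),
      r.Ξ.pullΞ S.lam ((run r).cuOf S), r.wlo / S.lam, r.whi / S.lam, Aff.const 0, Aff.const 0⟩
  | dg d, S => dg ⟨d4Pull d.o S.swap (S.neg 0) (S.neg 1), d.T.pullT S.lam ((dg d).cuOf S) ((dg d).cvOf S),
      d.Ξ.pullΞ S.lam ((dg d).cuOf S), d.wlo / S.lam, d.whi / S.lam, Aff.const 0, Aff.const 0⟩

variable (e : ElemQ) (S : Simil)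

/-- The abscissa coefficients of the pulled element. [folklore] -/
theorem uC_pull : (e.pull S).uC = S.pullC e.uC := by
  cases e with
  | run r => exact (d4Pull_rows S r.o).1
  | dg d =>
    obtain ⟨h1, h2⟩ := d4Pull_rows S d.o
    simp only [pull, uC]
    have := S.pullC_sub (d4a d.o, d4b d.o) (d4c d.o, d4d d.o)
    rw [← h1, ← h2] at this
    exact this.symm

/-- The ordinate coefficients of the pulled element. [folklore] -/
theorem vC_pull : (e.pull S).vC = S.pullC e.vC := by
  cases e with
  | run r => exact (d4Pull_rows S r.o).2
  | dg d =>
    obtain ⟨h1, h2⟩ := d4Pull_rows S d.o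
    simp only [pull, vC]
    have := S.pullC_add (d4a d.o, d4b d.o) (d4c d.o, d4d d.o)
    rw [← h1, ← h2] at this
    exact this.symm

/-- **The frame abscissa after the similarity.** [folklore] -/
theorem uOf_app (z : E²) : e.uOf (S.app z) = S.lam * (e.pull S).uOf z + e.cuOf S := by
  rw [uOf, uOf, uC_pull, S.form_app e.uC z, cuOf]; push_cast; ring

/-- **The frame ordinate after the similarity.** [folklore] -/
theorem vOf_app (z : E²) : e.vOf (S.app z) = S.lam * (e.pull S).vOf z + e.cvOf S := by
  rw [vOf, vOf, vC_pull, S.form_app e.vC z, cvOf]; push_cast; ring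

/-- The material map of the pulled element. [folklore] -/
theorem xi_pull : (e.pull S).xi = e.xi.pullΞ S.lam (e.cuOf S) := by cases e <;> rfl

/-- The line of the pulled element. [folklore] -/
theorem line_pull (hl : S.lam ≠ 0) (α u : ℝ) :
    (e.pull S).line α u = (e.line α (S.lam * u + e.cuOf S) - e.cvOf S) / S.lam := by
  cases e with
  | run r => simp [pull, line, Aff.eval_smul, Aff.eval_sub, Aff.eval_const]; ring
  | dg d => simp only [pull, line]; exact d.T.val_pullT hl _ _ α u

/-- **The scalar of the pulled element is the scalar after the similarity** (positive scale). [folklore] -/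
theorem scalar_pull (hl : 0 < S.lam) (t₀ τ : ℝ) (G : ℝ → ℝ) (t : ℝ) (z : E²) :
    (e.pull S).scalar t₀ τ G t z = e.scalar t₀ τ G t (S.app z) := by
  have hl0 : S.lam ≠ 0 := hl.ne'
  have hl' : (S.lam : ℝ) ≠ 0 := by exact_mod_cast hl0
  rw [scalar_frame, scalar_frame, e.uOf_app S z, e.vOf_app S z, e.line_pull S hl0, xi_pull, Pw.du_pullΞ _ hl0]
  congr 1
  -- numerator and denominator are both divided by `λ`
  set D := e.xi.du (clock t₀ τ t) (S.lam * (e.pull S).uOf z + e.cuOf S)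
  set L := e.line (clock t₀ τ t) (S.lam * (e.pull S).uOf z + e.cuOf S)
  have : (e.pull S).vOf z - (L - e.cvOf S) / S.lam = (S.lam * (e.pull S).vOf z + e.cvOf S - L) / S.lam := by
    field_simp; ring
  rw [this, div_div_div_cancel_right₀ hl']

end ElemQ


/-! ## Preimages of rectangles and strips under a similarity -/

/-- **Pull-back of a rational linear form** by the linear part of a similarity. [folklore] -/
def pullCQ (sw n0 n1 : Bool) (c : ℚ × ℚ) : ℚ × ℚ :=
  let s0 : ℚ := if n0 then -1 else 1
  let s1 : ℚ := if n1 then -1 else 1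
  if sw then (c.2 * s1, c.1 * s0) else (c.1 * s0, c.2 * s1)

namespace Simil

variable (S : Simil)

/-- **A rational linear form after the similarity.** [folklore] -/
theorem formQ_app (c : ℚ × ℚ) (z : E²) :
    (c.1 : ℝ) * S.app z 0 + (c.2 : ℝ) * S.app z 1 =
      S.lam * (((pullCQ S.swap (S.neg 0) (S.neg 1) c).1 : ℝ) * z 0 + ((pullCQ S.swap (S.neg 0) (S.neg 1) c).2 : ℝ) * z 1) +
        ((c.1 : ℝ) * S.w 0 + (c.2 : ℝ) * S.w 1) := by
  obtain ⟨sw, ng, lam, w⟩ := S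
  simp only [app_apply, pullCQ, src, sg]
  rcases Bool.eq_false_or_eq_true (ng 0) with h0 | h0 <;> rcases Bool.eq_false_or_eq_true (ng 1) with h1 | h1 <;>
    cases sw <;> simp [h0, h1, GateC.oth] <;> ring

end Simil

namespace RectQ

variable (R : RectQ) (S : Simil)

/-- **Preimage of a rectangle** under a similarity of positive scale. [folklore] -/
def preim : RectQ :=
  ⟨fun i => if S.neg (S.src i) then (S.w (S.src i) - R.hi (S.src i)) / S.lam else (R.lo (S.src i) - S.w (S.src i)) / S.lam,
    fun i => if S.neg (S.src i) then (S.w (S.src i) - R.lo (S.src i)) / S.lam else (R.hi (S.src i) - S.w (S.src i)) / S.lam⟩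

variable {R S}

/-- One coordinate of the preimage condition. [folklore] -/
theorem preim_coord_iff (hl : 0 < S.lam) (z : E²) (i : Fin 2) :
    (((R.preim S).lo i : ℝ) ≤ z i ∧ z i ≤ ((R.preim S).hi i : ℝ)) ↔
      ((R.lo (S.src i) : ℝ) ≤ S.app z (S.src i) ∧ S.app z (S.src i) ≤ (R.hi (S.src i) : ℝ)) := by
  have hl' : (0 : ℝ) < S.lam := by exact_mod_cast hl
  rw [Simil.app_apply, S.src_src]
  simp only [preim, Simil.sg]
  by_cases hn : S.neg (S.src i) = true
  · simp only [hn, ↓reduceIte]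
    push_cast
    rw [div_le_iff₀ hl', le_div_iff₀ hl']
    constructor <;> rintro ⟨h1, h2⟩ <;> constructor <;> nlinarith
  · simp only [hn, Bool.false_eq_true, ↓reduceIte]
    push_cast
    rw [div_le_iff₀ hl', le_div_iff₀ hl']
    constructor <;> rintro ⟨h1, h2⟩ <;> constructor <;> nlinarith

/-- **Membership in the preimage rectangle.** [folklore] -/
theorem mem_preim_iff (hl : 0 < S.lam) (z : E²) : (R.preim S).mem z ↔ R.mem (S.app z) := by
  constructor
  · intro h j
    have := (preim_coord_iff (R := R) hl z (S.src j)).1 (h (S.src j))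
    rwa [S.src_src] at this
  · intro h i
    exact (preim_coord_iff (R := R) hl z i).2 (h (S.src i))

namespace StripQ

/-- **Preimage of a strip** under a similarity. [folklore] -/
def preim (T : StripQ) (S : Simil) : StripQ :=
  let c := pullCQ S.swap (S.neg 0) (S.neg 1) (T.a0, T.a1)
  ⟨S.lam * c.1, S.lam * c.2, T.lo - (T.a0 * S.w 0 + T.a1 * S.w 1), T.hi - (T.a0 * S.w 0 + T.a1 * S.w 1)⟩

/-- **Membership in the preimage strip.** [folklore] -/
theorem mem_preim_iff (T : StripQ) (S : Simil) (z : E²) : (T.preim S).mem z ↔ T.mem (S.app z) := by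
  simp only [StripQ.mem, preim]
  rw [S.formQ_app (T.a0, T.a1) z]
  push_cast
  constructor <;> rintro ⟨h1, h2⟩ <;> constructor <;> linarith

end StripQ

end RectQ

/-! ## Similar re-descriptions: the certificate and its soundness -/

namespace PhaseQ

variable (P : PhaseQ)

/-- **Similar cover entry** for node `k` of `P` (frozen at end `e`) against `P'` (frozen at end
`e'`) seen through the similarity `S`, inside the region `Q`: for every annotated piece of `k`,
the listed nodes of `P'` carry an equivalence certificate between the element of `k` and their
element PULLED BACK by `S`, and the preimages of their tube rectangles chain-cover the part of
the tube rectangle of `k` inside `Q` and the two strips of the piece. [folklore] -/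
def simEntryB (e : Bool) (P' : PhaseQ) (e' : Bool) (S : Simil) (Q : RectQ) (k : ℕ)
    (entry : Fin 2 × List (ℕ × EquivCert)) : Bool :=
  let R := (P.tubeRect k e).inter Q
  (entry.2.all fun kc => decide (kc.1 < P'.K)) &&
    (P.node k).ann.pieces.all fun π =>
      match (P.node k).e.pieceStripO π P.r₀ e with
      | none => false
      | some T =>
        let good := entry.2.filter fun kc =>
          ElemQ.certOnPieceB (P.node k).e e π T ((P'.node kc.1).e.pull S) e' (R.inter ((P'.tubeRect kc.1 e').preim S)) kc.2
        R.chainCovers2B T ((P.node k).e.pieceUStrip π e) entry.1 (good.map fun kc => (P'.tubeRect kc.1 e').preim S)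

/-- **Similar re-description certificate** between `P` at end `e` and `P'` at end `e'` through the
similarity `S` on the region `Q` (in the coordinates of `P`): step signs `±1`, positive scale, one
similar cover entry per node of `P` (through `S`, inside `Q`) and one per node of `P'` (through
`S⁻¹`, inside `S(Q)`). [folklore] -/
def simRedescribeB (e : Bool) (P' : PhaseQ) (e' : Bool) (S : Simil) (Q : RectQ)
    (cert cert' : List (Fin 2 × List (ℕ × EquivCert))) : Bool :=
  P.sgnsOKB && P'.sgnsOKB && decide (0 < S.lam) && decide (cert.length = P.K) && decide (cert'.length = P'.K) &&
    (List.range P.K).all (fun k => P.simEntryB e P' e' S Q k (cert.getD k (0, []))) &&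
    (List.range P'.K).all (fun k' => P'.simEntryB e' P e S.inv (Q.preim S.inv) k' (cert'.getD k' (0, [])))

variable {P}

/-- **One direction of the similar cover**: at a point of `Q` (both the point and its image in the
closed square) where element `k` of `P` is active with a nonzero value, `P'` has the same
assembled scalar value at the image point. [folklore] -/
theorem scalar_eq_of_simEntry {G : ℝ → ℝ} {M : ℝ} {P' : PhaseQ} (hGP' : ProfileHyp G M P'.r₀)
    (hg : P.geomB = true) (hsep : P.boxSepB = true) (hA : P.JAgree G)
    (hg' : P'.geomB = true) (hsep' : P'.boxSepB = true) (hA' : P'.JAgree G) (hs : P.sgnsOKB = true) (hs' : P'.sgnsOKB = true)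
    {S : Simil} (hl : 0 < S.lam) {Q : RectQ}
    {e e' : Bool} {k : ℕ} (hk : k < P.K) {entry : Fin 2 × List (ℕ × EquivCert)} (hc : P.simEntryB e P' e' S Q k entry = true)
    {t t' : ℝ} (ht : clock P.T0 P.Tau t = endVal e) (ht' : clock P'.T0 P'.Tau t' = endVal e')
    {z : E²} (hzQ : Q.mem z) (hsq : ∀ j, 0 ≤ z j ∧ z j ≤ 1) (hsq' : ∀ j, 0 ≤ S.app z j ∧ S.app z j ≤ 1)
    (hp : (t, z) ∈ P.chain.tubeBox k ∩ P.Band k) (hne : P.Θ G k t z ≠ 0) :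
    P'.scalar G t' (S.app z) = P.scalar G t z := by
  have hpos : P.allPosB = true := (geomB_at hg hk).2.1
  simp only [simEntryB, Bool.and_eq_true, List.all_eq_true, decide_eq_true_eq] at hc
  obtain ⟨hall, hcov⟩ := hc
  have hzR : ((P.tubeRect k e).inter Q).mem z := RectQ.mem_inter ((mem_tubeRect_iff hpos hs hk ht z).2 hp.1) hzQ
  have hv : P.elemsValidB = true := (geomB_at hg hk).1
  have hvk := validB_node hv hk
  have hpcs : P.piecesB k = true := (geomB_at hg hk).2.2.2.2
  simp only [piecesB, Bool.and_eq_true] at hpcs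
  have hOK := hpcs.1
  have hzsupp : z ∈ ((P.node k).box.frzAt (clock P.T0 P.Tau t)).supp := hp.1.1.1
  obtain ⟨π, hπ, hu, hreg⟩ := (P.node k).e.exists_piece hvk hOK hp.2 hzsupp
  have hcovπ := hcov π hπ
  have hv' : P'.elemsValidB = true := by
    simp only [geomB, Bool.and_eq_true] at hg'; exact hg'.1.1
  -- a listed node with a certificate valid on the piece, the preimage of whose tube rectangle contains the point
  obtain ⟨kc, hk'mem, hcert, hzS⟩ : ∃ kc ∈ entry.2,
      ElemQ.certOnPieceB (P.node k).e e π
        (((P.node k).e.pieceStripO π P.r₀ e).getD RectQ.StripQ.univ) ((P'.node kc.1).e.pull S) e'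
        (((P.tubeRect k e).inter Q).inter ((P'.tubeRect kc.1 e').preim S)) kc.2 = true ∧
        ((P'.tubeRect kc.1 e').preim S).mem z := by
    revert hcovπ
    cases hT : (P.node k).e.pieceStripO π P.r₀ e with
    | none => intro h; exact absurd h (by simp)
    | some T =>
      intro h
      have hr0 := (P.node k).e.r0_nonneg_of_piecesOKB hOK
      obtain ⟨hT1, hT2⟩ := ElemQ.mem_pieceStrips hvk hr0 ht hp.2 hreg hu hT
      obtain ⟨Srect, hS, hzS⟩ := RectQ.exists_mem_of_chainCovers2B h hzR hT1 hT2
      obtain ⟨kc, hkc, rfl⟩ := List.mem_map.1 hS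
      obtain ⟨hmem, hgood⟩ := List.mem_filter.1 hkc
      exact ⟨kc, hmem, by simpa using hgood, hzS⟩
  have hk' : kc.1 < P'.K := hall kc hk'mem
  set k' := kc.1 with hk'def
  have hpos' : P'.allPosB = true := (geomB_at hg' hk').2.1
  have hzS' : (P'.tubeRect k' e').mem (S.app z) := (RectQ.mem_preim_iff hl z).1 hzS
  have htube' : (t', S.app z) ∈ P'.chain.tubeBox k' := (mem_tubeRect_iff hpos' hs' hk' ht' (S.app z)).1 hzS'
  -- the element scalars agree (through the pull-back), hence `Θ'_{k'} ≠ 0` at the image point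
  have huE : (P.node k).e.uOf z ∈ Icc (π.ua.eval (endVal e)) (π.ub.eval (endVal e)) := by rw [← ht]; exact hu
  have hTmem : (((P.node k).e.pieceStripO π P.r₀ e).getD RectQ.StripQ.univ).mem z := by
    cases hT : (P.node k).e.pieceStripO π P.r₀ e with
    | none => simpa using RectQ.StripQ.mem_univ z
    | some T =>
      have hr0 := (P.node k).e.r0_nonneg_of_piecesOKB hOK
      simpa using (ElemQ.mem_pieceStrips hvk hr0 ht hp.2 hreg hu hT).1
  have helem : P.Θ G k t z = P'.Θ G k' t' (S.app z) := by
    have := ElemQ.scalar_eq_of_certOnPieceB hcert hGP'.even ht ht' (RectQ.mem_inter hzR hzS) hTmem huE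
    rw [ElemQ.scalar_pull _ _ hl] at this
    exact this
  have hband' : (t', S.app z) ∈ P'.Band k' :=
    (P'.facts hGP'.smooth hGP'.bound hGP'.nonneg hGP'.supp hv').band k' hk' (t', S.app z) (by rw [← helem]; exact hne)
  rw [scalar_eq_elem hg hsep hA hk hsq hp, scalar_eq_elem hg' hsep' hA' hk' hsq' ⟨htube', hband'⟩, helem]

/-- **The similar re-description theorem**: two checked phases with junction agreement and a valid
similar re-description certificate through `S` on `Q` have the same assembled scalar at `z` and
`S z`, for every `z ∈ Q` with `z` and `S z` in the closed square, at any two times where their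
clocks take the certified end values. [folklore] -/
theorem scalar_eq_of_simRedescribeB {G : ℝ → ℝ} {M : ℝ} {P' : PhaseQ} (hGP : ProfileHyp G M P.r₀) (hGP' : ProfileHyp G M P'.r₀)
    (hg : P.geomB = true) (hsep : P.boxSepB = true) (hA : P.JAgree G)
    (hg' : P'.geomB = true) (hsep' : P'.boxSepB = true) (hA' : P'.JAgree G)
    {S : Simil} {Q : RectQ} {e e' : Bool} {cert cert' : List (Fin 2 × List (ℕ × EquivCert))}
    (hc : P.simRedescribeB e P' e' S Q cert cert' = true)
    {t t' : ℝ} (ht : clock P.T0 P.Tau t = endVal e) (ht' : clock P'.T0 P'.Tau t' = endVal e')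
    {z : E²} (hzQ : Q.mem z) (hsq : ∀ j, 0 ≤ z j ∧ z j ≤ 1) (hsq' : ∀ j, 0 ≤ S.app z j ∧ S.app z j ≤ 1) :
    P.scalar G t z = P'.scalar G t' (S.app z) := by
  simp only [simRedescribeB, Bool.and_eq_true, List.all_eq_true, List.mem_range, decide_eq_true_eq] at hc
  obtain ⟨⟨⟨⟨⟨⟨hs, hs'⟩, hl⟩, -⟩, -⟩, hcov⟩, hcov'⟩ := hc
  have hl0 : S.lam ≠ 0 := hl.ne'
  have hli : 0 < S.inv.lam := by rw [Simil.inv_lam]; positivity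
  have hzw : S.inv.app (S.app z) = z := Simil.inv_app_app hl0 z
  by_cases h1 : ∃ k < P.K, (t, z) ∈ P.chain.tubeBox k ∩ P.Band k ∧ P.Θ G k t z ≠ 0
  · obtain ⟨k, hk, hp, hne⟩ := h1
    exact (scalar_eq_of_simEntry hGP' hg hsep hA hg' hsep' hA' hs hs' hl hk (hcov k hk) ht ht' hzQ hsq hsq' hp hne).symm
  · push Not at h1
    have hP0 : P.scalar G t z = 0 := by
      by_cases h2 : ∃ k < P.K, (t, z) ∈ P.chain.tubeBox k ∩ P.Band k
      · obtain ⟨k, hk, hp⟩ := h2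
        rw [scalar_eq_elem hg hsep hA hk hsq hp]; exact h1 k hk hp
      · push Not at h2
        exact scalar_eq_zero_off hGP.smooth hGP.bound hGP.nonneg hGP.supp hg hsep h2
    by_cases h3 : ∃ k' < P'.K, (t', S.app z) ∈ P'.chain.tubeBox k' ∩ P'.Band k' ∧ P'.Θ G k' t' (S.app z) ≠ 0
    · obtain ⟨k', hk', hp', hne'⟩ := h3
      -- the other direction, through `S⁻¹` at the image point
      have hzQ' : (Q.preim S.inv).mem (S.app z) := (RectQ.mem_preim_iff hli (S.app z)).2 (by rw [hzw]; exact hzQ)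
      have hsq'' : ∀ j, 0 ≤ S.inv.app (S.app z) j ∧ S.inv.app (S.app z) j ≤ 1 := by rw [hzw]; exact hsq
      have := scalar_eq_of_simEntry hGP hg' hsep' hA' hg hsep hA hs' hs hli hk' (hcov' k' hk') ht' ht hzQ' hsq' hsq'' hp' hne'
      rw [hzw] at this
      rw [this]
    · push Not at h3
      have hP'0 : P'.scalar G t' (S.app z) = 0 := by
        by_cases h4 : ∃ k' < P'.K, (t', S.app z) ∈ P'.chain.tubeBox k' ∩ P'.Band k'
        · obtain ⟨k', hk', hp'⟩ := h4
          rw [scalar_eq_elem hg' hsep' hA' hk' hsq' hp']; exact h3 k' hk' hp'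
        · push Not at h4
          exact scalar_eq_zero_off hGP'.smooth hGP'.bound hGP'.nonneg hGP'.supp hg' hsep' h4
      rw [hP0, hP'0]

end PhaseQ

/-! ## The placement of a child cell -/

namespace Simil

open QuasiSelfSimilar FunctionSpaces FunctionSpaces.Torus

/-- **The similarity of a child placement**: `z ↦ σ⁻¹ • (5 z - p)` for the code `c` of `σ` and
the cell `p` of `𝒯_{1/5}`. [folklore] -/
def ofChild (c : SymmCode) (p : Fin 2 → Fin 5) : Simil :=
  let src : Fin 2 → Fin 2 := fun j => if c.swap then GateC.oth j else j
  ⟨c.swap, fun j => c.flip (src j), 5,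
    fun j => if c.flip (src j) then 1 + ((p (src j) : ℕ) : ℚ) else -((p (src j) : ℕ) : ℚ)⟩

/-- The scale of a child placement is `5`. [folklore] -/
@[simp] theorem ofChild_lam (c : SymmCode) (p : Fin 2 → Fin 5) : (ofChild c p).lam = 5 := rfl

/-- The code permutation is the source map. [folklore] -/
theorem perm_symm_apply (c : SymmCode) (j : Fin 2) : c.perm.symm j = (if c.swap then GateC.oth j else j) := by
  unfold SymmCode.perm
  cases c.swap <;> fin_cases j <;> rfl

/-- **The child placement is the similarity of the self-similarity clause**:
`(ofChild c p) z = (c.toSymm)⁻¹ • (5 z - p)`. [folklore] -/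
theorem ofChild_app (c : SymmCode) (p : Fin 2 → Fin 5) (z : E²) :
    (ofChild c p).app z = c.toSymm.inv.act ((5 : ℝ) • z - latticeVec fun k => ((p k : ℕ) : ℤ)) := by
  ext j
  rw [app_apply, SquareSymm.act_apply]
  simp only [SquareSymm.inv, SymmCode.toSymm_perm, SymmCode.toSymm_flip, perm_symm_apply, ofChild, src, sg,
    PiLp.sub_apply, PiLp.smul_apply, smul_eq_mul, latticeVec_apply]
  split_ifs with h <;> push_cast <;> ring

/-- The rational rectangle of the cell `p` of `𝒯_{1/5}`. [folklore] -/
def cellRect (p : Fin 2 → Fin 5) : RectQ := ⟨fun i => ((p i : ℕ) : ℚ) / 5, fun i => (((p i : ℕ) : ℚ) + 1) / 5⟩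

/-- A point of the open cell lies in the cell rectangle, in the closed square, and is placed in
the closed square. [folklore] -/
theorem cell_facts (c : SymmCode) (p : Fin 2 → Fin 5) {z : E²}
    (hz : z ∈ latticeCellInterior 5 fun k => ((p k : ℕ) : ℤ)) :
    (cellRect p).mem z ∧ (∀ j, 0 ≤ z j ∧ z j ≤ 1) ∧ (∀ j, 0 ≤ (ofChild c p).app z j ∧ (ofChild c p).app z j ≤ 1) := by
  rw [mem_latticeCellInterior] at hz
  have hb : ∀ i, ((p i : ℕ) : ℝ) / 5 < z i ∧ z i < (((p i : ℕ) : ℝ) + 1) / 5 := fun i => by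
    have := hz i; simp only [Int.cast_natCast, Nat.cast_ofNat] at this; exact this
  have hp4 : ∀ i, ((p i : ℕ) : ℝ) ≤ 4 := fun i => by
    have : (p i : ℕ) ≤ 4 := Nat.lt_succ_iff.mp (p i).isLt
    exact_mod_cast this
  refine ⟨fun i => ?_, fun j => ?_, fun j => ?_⟩
  · simp only [cellRect]
    push_cast
    exact ⟨(hb i).1.le, (hb i).2.le⟩
  · have := hb j; have := hp4 j
    have h0 : (0 : ℝ) ≤ ((p j : ℕ) : ℝ) := by positivity
    constructor
    · linarith [(hb j).1, div_nonneg h0 (by norm_num : (0:ℝ) ≤ 5)]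
    · have : z j < 1 := by
        have := (hb j).2
        calc z j < (((p j : ℕ) : ℝ) + 1) / 5 := this
          _ ≤ (4 + 1) / 5 := by gcongr
          _ = 1 := by norm_num
      exact this.le
  · rw [app_apply]
    simp only [ofChild, sg, src]
    set i := (if c.swap then GateC.oth j else j) with hi
    have h1 := (hb i).1; have h2 := (hb i).2
    rw [div_lt_iff₀ (by norm_num : (0:ℝ) < 5)] at h1
    rw [lt_div_iff₀ (by norm_num : (0:ℝ) < 5)] at h2
    by_cases hf : c.flip i = true
    · simp only [hf, ↓reduceIte]; push_cast; constructor <;> nlinarith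
    · simp only [hf, Bool.false_eq_true, ↓reduceIte]; push_cast; constructor <;> nlinarith

end Simil

end PlanarKinematics

end Literature.Analysis.FluidPDE
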